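import Summits.BirchSwinnertonDyer.Rank1Residual.P2.CongruentNumberSilentEvenFiveEnclosureBridged
import Summits.BirchSwinnertonDyer.Rank1Residual.P2.CongruentNumberSilentEvenFiveSelmerEightAoki
import Summits.BirchSwinnertonDyer.Rank1Residual.P2.CongruentNumberEvenFiveFamilyRedeiFree
import Literature.NumberTheory.EllipticCurves.Tian2014.CMPointSystemBridgeMaximal
import HarnessLib

/-!
# Cell «bsd-monsky» (prover-A): THE ENCLOSURE RELATIVE TO THE MAXIMAL SYSTEM FACT — C-P2-1 from ONE `2`-Selmer input
# (`hAo` Aoki 1999 Thm. 2.2 | `hMe` Heath-Brown 1994 | `h515` Monsky 1990) and `tian2014_system_sMinus_maximal`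
# (Tian Thm. 2.8 system ∧ TYZ Thm. 3.3 at `χ₀` ∧ TYZ p. 749 through `ϕ` ∧ the seven one-sentence displays of Tian
# Def. 2.7 / p0003 / Prop. 2.1 and TYZ §3.1 / J747 / J751 / Lemma 3.16 ∧ Gauss genus theory); and the whole even-five
# two-prime family from `{hTYZ, hGZK, hAo | hMe, hSys⁗}` with no Rédei–Reichardt binder

HONEST FRAMING: nothing asserted; conditional on the displayed fact `hSys⁗` (`Tian2014.tian2014_system_sMinus_maximal`)
and on ONE `2`-Selmer input. Compared with the bridged form (`…EnclosureBridged.lean`, p406739), the point identification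
«`z = u·ϕ(z_N) + t₀ + (1+√2, 2+√2)`» (PROOF-A (8.1.4), the sentence on which the (B4) flag sat alone) is no longer
displayed: it is the kernel theorem `CMPointData.BridgeData.tianPointIdentification_of_maximalDisplays` of the seven
displays `tianDefZ` (Def. 2.7), `fEqPhi` («`f` unique up to `−1`»), `tianTA` (`T(A) = t_{[0],−1}`), `tianTB` (`T(B)` of
exact order `4`), `tyzZN` (`z_N = f₀([i]P_N)`), `wEqPhiZN` (`w = ϕ(z_N)`), `phiIotaCuspTwoTorsion` (`2·ϕ([i][0]) = 0`),
with the two matrix identities of (8.1.2) checked in the kernel. One-line compositions; nothing booked. (The `k = 2` rung of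
C-P2-2 from the same fact set is the sequel `P2/CongruentNumberSilentEvenFiveEnclosureRungTwoMaximal.lean`.)
-/

noncomputable section

open scoped Classical

open WeierstrassCurve Literature.NumberTheory.EllipticCurves
  Literature.NumberTheory.EllipticCurves.Monsky1990
  Literature.NumberTheory.EllipticCurves.Rank1Residual.Typed

set_option autoImplicit false

namespace Summit.BirchSwinnertonDyer.Rank1Residual.P2

open Conjectures Literature.NumberTheory.EllipticCurves.Tian2014
  Literature.NumberTheory.EllipticCurves.HeathBrown1994
  Literature.NumberTheory.EllipticCurves.Aoki1999
  Literature.NumberTheory.EllipticCurves.Rank1Residual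
  Literature.NumberTheory.EllipticCurves.TianYuanZhang2017

/-! ## §1 C-P2-1 on `𝒮⁻` from the maximal system fact and one `2`-Selmer input -/

/-- **C-P2-1 relative to Aoki 1999's Selmer count and the MAXIMAL system fact** (no Cor 5.15, no HB94, no assembled
point identification). Sorry-free; nothing asserted. [cite: Aoki1999, Thm. 2.2 p. 81] [cite: Tian2014, Thm. 2.8 (J132), Def. 2.7, Prop. 2.1]
[cite: TianYuanZhang2017, Thm. 3.3 (p. 739), p. 749, J747, J751] [cite: Miller2011LMS, Def. 1.1] -/
theorem congruentSilentEvenFiveBSDTwo_of_maximalSystem_of_aoki (hAo : thm22_card_selmerGroup_two)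
    (hSys : tian2014_system_sMinus_maximal) : CongruentSilentEvenFiveBSDTwo :=
  congruentSilentEvenFiveBSDTwo_of_genusSystem_of_aoki hAo
    (tian2014_system_sMinus_genus_of_split
      (tian2014_system_sMinus_split_of_bridged (tian2014_system_sMinus_bridged_of_maximal hSys)))

/-- **C-P2-1, `ord` form, relative to Aoki 1999's Selmer count and the MAXIMAL system fact.** Sorry-free; nothing asserted.
[cite: Aoki1999, Thm. 2.2 p. 81] [cite: Tian2014, Thm. 2.8 (J132), Def. 2.7, Prop. 2.1] [cite: TianYuanZhang2017, Thm. 3.3 (p. 739), p. 749, J747, J751] -/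
theorem congruentSilentEvenFiveOrdTwo_of_maximalSystem_of_aoki (hAo : thm22_card_selmerGroup_two)
    (hSys : tian2014_system_sMinus_maximal) : CongruentSilentEvenFiveOrdTwo :=
  congruentSilentEvenFiveOrdTwo_of_genusSystem_of_aoki hAo
    (tian2014_system_sMinus_genus_of_split
      (tian2014_system_sMinus_split_of_bridged (tian2014_system_sMinus_bridged_of_maximal hSys)))

/-- **C-P2-1 relative to Heath-Brown 1994's Selmer count and the MAXIMAL system fact.** Sorry-free; nothing asserted.
[cite: HeathBrown1994SelmerCongruentII, Appendix (Monsky)] [cite: Tian2014, Thm. 2.8 (J132), Def. 2.7, Prop. 2.1]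
[cite: TianYuanZhang2017, Thm. 3.3 (p. 739), p. 749, J747, J751] [cite: Miller2011LMS, Def. 1.1] -/
theorem congruentSilentEvenFiveBSDTwo_of_maximalSystem_of_monskyEven (hMe : monsky_card_selmerGroup_two_even)
    (hSys : tian2014_system_sMinus_maximal) : CongruentSilentEvenFiveBSDTwo :=
  congruentSilentEvenFiveBSDTwo_of_bridgedSystem_of_monskyEven hMe (tian2014_system_sMinus_bridged_of_maximal hSys)

/-- **C-P2-1 relative to Monsky 1990 Cor. 5.15 and the MAXIMAL system fact.** Sorry-free; nothing asserted.
[cite: Monsky1990MockHeegner, Cor. 5.15 (p. 66), Remark (2) (p. 67)] [cite: Tian2014, Thm. 2.8 (J132), Def. 2.7, Prop. 2.1]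
[cite: TianYuanZhang2017, Thm. 3.3 (p. 739), p. 749, J747, J751] [cite: Miller2011LMS, Def. 1.1] -/
theorem congruentSilentEvenFiveBSDTwo_of_maximalSystem
    (h515 : cor515_rank_eq_one_and_card_selmerGroup_two) (hSys : tian2014_system_sMinus_maximal) :
    CongruentSilentEvenFiveBSDTwo :=
  congruentSilentEvenFiveBSDTwo_of_bridgedSystem h515 (tian2014_system_sMinus_bridged_of_maximal hSys)

/-! ## §2 The whole even-five two-prime family, no Rédei–Reichardt binder -/

/-- **`BSD(E_{2pq}, 2)` for ALL primes `p ≡ 5 (mod 8)`, `q ≡ 3 (mod 4)` from `{hTYZ, hGZK, hAo, hSys⁗}`** — TYZ §3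
data, GZK, Aoki's refereed count and the maximal system fact; no Monsky 1990, no Heath-Brown 1994, no Rédei–Reichardt
binder, no assembled sentence. Conditional; nothing asserted.
[cite: TianYuanZhang2017, Thm. 1.2, Thm. 3.3, Thm. 3.5 and §1 (1.1)] [cite: Aoki1999, Thm. 2.2 p. 81]
[cite: Tian2014, Thm. 2.8 (J132), Def. 2.7, Prop. 2.1] [cite: Miller2011LMS, Def. 1.1] -/
theorem forall_bsdp_two_congruentNumberCurve_two_mul_five_mul_of_maximalSystem_of_aoki
    (hTYZ : tyz_genusPointData) (hGZK : rank_eq_analyticRank_of_analyticRank_le_one)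
    (hAo : thm22_card_selmerGroup_two) (hSys : tian2014_system_sMinus_maximal) :
    ∀ p q : ℕ, p.Prime → q.Prime → p % 8 = 5 → q % 4 = 3 →
      BSDp (congruentNumberCurve (2 * (p * q))) 2 :=
  RedeiFree.forall_bsdp_two_congruentNumberCurve_two_mul_five_mul_of_genusSystem_of_aoki hTYZ hGZK hAo
    (tian2014_system_sMinus_genus_of_split
      (tian2014_system_sMinus_split_of_bridged (tian2014_system_sMinus_bridged_of_maximal hSys)))

/-- **`BSD(E_{2pq}, 2)` for ALL primes `p ≡ 5 (mod 8)`, `q ≡ 3 (mod 4)` from `{hTYZ, hGZK, hMe, hSys⁗}`.** Conditional;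
nothing asserted. [cite: TianYuanZhang2017, Thm. 1.2, Thm. 3.3, Thm. 3.5 and §1 (1.1)]
[cite: HeathBrown1994SelmerCongruentII, Appendix (Monsky)] [cite: Tian2014, Thm. 2.8 (J132), Def. 2.7, Prop. 2.1] [cite: Miller2011LMS, Def. 1.1] -/
theorem forall_bsdp_two_congruentNumberCurve_two_mul_five_mul_of_maximalSystem_of_monskyEven
    (hTYZ : tyz_genusPointData) (hGZK : rank_eq_analyticRank_of_analyticRank_le_one)
    (hMe : monsky_card_selmerGroup_two_even) (hSys : tian2014_system_sMinus_maximal) :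
    ∀ p q : ℕ, p.Prime → q.Prime → p % 8 = 5 → q % 4 = 3 →
      BSDp (congruentNumberCurve (2 * (p * q))) 2 :=
  RedeiFree.forall_bsdp_two_congruentNumberCurve_two_mul_five_mul_of_genusSystem_of_monskyEven hTYZ hGZK hMe
    (tian2014_system_sMinus_genus_of_split
      (tian2014_system_sMinus_split_of_bridged (tian2014_system_sMinus_bridged_of_maximal hSys)))

end Summit.BirchSwinnertonDyer.Rank1Residual.P2

end
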